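import Literature.Algebra.Homology.OrderedCechHomotopyRetract
import Literature.Algebra.Homology.LaurentCech
import Literature.Analysis.Complex.LaurentSeparation
import Literature.Analysis.Complex.PolynomialGrowthLiouvilleSCV
import Mathlib.Algebra.MvPolynomial.Funext
import HarnessLib

/-!
# GAGA for the twisting sheaves `𝒪(n)` on `ℙ_r(ℂ)`: the algebraic Čech complex computes the
holomorphic Čech cohomology (Serre 1956, n° 13 Lemmes 4–5, by Frenkel's Laurent method)

Let `U_i = {x_i ≠ 0} ⊂ ℙ_r(ℂ)` be the standard cover. A holomorphic section of `𝒪(n)^h` over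
`U_s = ⋂_{i ∈ s} U_i` (`s ≠ ∅`) is a holomorphic function on the cone
`Û_s = {x ∈ ℂ^{r+1} : x_i ≠ 0 ∀ i ∈ s}` which is homogeneous of degree `n` (Serre, GAGA n° 16),
and an algebraic section is such a function which is a Laurent polynomial with poles only along
the `x_i`, `i ∈ s`. Restricting everything to the torus `T = Û_{0…r} = (ℂˣ)^{r+1}` (restriction
is injective by the identity theorem) both kinds of sections become members of ONE ambient module
`𝕂 = Γ(T, 𝒪)` (modelled here as the functions on `ℂ^{r+1}` holomorphic on `T` and zero off `T`),
and the two ordered Čech complexes are the complexes `Č•(G_n) ⊆ Č•(F_n)` of the monotone families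

* `F_n(s)` = `holFamily r n s` — functions agreeing on `T` with a holomorphic function on `Û_s`
  homogeneous of degree `n`;
* `G_n(s)` = `algFamily r n s` — evaluations of the Laurent polynomials in Serre's localized
  piece `LaurentCech.locDeg 0 ⊤ s n` (degree `n`, poles along `s`), i.e. the members of the
  tree's algebraic Čech complex `LaurentCech.cech (fun _ => 0) ⊤ n` of `𝒪(n)` [Serre FAC n° 64].

**Main result** (`quasiIso_cechComparison`): the evaluation map
`LaurentCech.cech (fun _ => 0) ⊤ n ⟶ Č•(F_n)` is a quasi-isomorphism, for every `r ≥ 0` and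
`n ∈ ℤ` — Serre's Théorème 1 of GAGA for the sheaves `𝒪(n)` on projective space, n° 13 Lemme 5
(whose proof contains Lemme 4, `H⁰`), obtained here, as Serre remarks in footnote (4) of n° 13,
"directement … au moyen de développements de Laurent (Frenkel)": the regular-part operators
`R_i` of `Literature.Analysis.Complex.LaurentSeparation` give endomorphisms
`T_i = S_0 ∘ ⋯ ∘ S_{i-1} ∘ R_i` (`S_i = id - R_i`) and `π = S_0 ∘ ⋯ ∘ S_r` of `𝕂` with
`Σ_i T_i + π = id`, `T_i (F(s ∪ i)) ⊆ F(s)`, `T_i (G(s ∪ i)) ⊆ G(s)`, and `π (F s) ⊆ G s` (for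
`s ≠ {0…r}` because `π` kills `F s`; for the torus itself this is the several-variable Laurent
separation: `π h` extends, after the inversion `y = x⁻¹`, to an entire function of polynomial
growth — Riemann extension + Liouville), and `F ∅ = G ∅` (entire homogeneous functions are
homogeneous polynomials); the relative cone-contraction criterion
`OrderedCech.quasiIso_complexMap_of_coneRetraction` then gives the quasi-isomorphism.

Consequences (read off from the algebraic side, `LaurentCech` / Serre FAC n° 65):
`Ȟ^q(𝔘^h, 𝒪(n)^h) = 0` for `0 < q < r` and `Ȟ⁰(𝔘^h, 𝒪(n)^h)` = homogeneous polynomials of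
degree `n` — without any Kähler / Dolbeault theory. This is the base case of the dévissage
proving GAGA Théorème 1 for all coherent algebraic sheaves on `ℙ_r(ℂ)`.

## References
* [cite: SerreGAGA1956, n° 13 Lemme 4, Lemme 5, footnote (4); n° 16] J.-P. Serre,
  *Géométrie algébrique et géométrie analytique*, Ann. Inst. Fourier 6 (1956) 1–42.
* [cite: SerreFAC1955, n° 64–65] J.-P. Serre, *Faisceaux algébriques cohérents*,
  Ann. of Math. 61 (1955) 197–278.
-/

noncomputable section

open Set Filter Function Complex CategoryTheory
open scoped Topology

namespace Literature.AlgebraicGeometry.HodgeTheory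

namespace GAGATwist

open Literature.Analysis.Complex.LaurentSeparation Literature.Algebra.Homology
  Literature.Algebra.Homology.LaurentCech Literature.Algebra.Homology.OrderedCech

variable {r : ℕ}

/-! ### The torus and the ambient module `𝕂 = Γ(T, 𝒪)` -/

variable (r) in
/-- The torus `T = (ℂˣ)^{r+1} ⊂ ℂ^{r+1}`, the cone over `U_0 ∩ ⋯ ∩ U_r ⊂ ℙ_r(ℂ)`.
[cite: SerreGAGA1956, n° 16] -/
def torus : Set (Fin (r + 1) → ℂ) := coordCone (Finset.univ : Finset (Fin (r + 1)))

/-- Membership in the torus: all coordinates are nonzero. [cite: SerreGAGA1956, n° 16] -/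
theorem mem_torus {x : Fin (r + 1) → ℂ} : x ∈ torus r ↔ ∀ i, x i ≠ 0 := by
  simp [torus, mem_coordCone]

/-- The torus lies in every cone `Û_s`. [cite: SerreGAGA1956, n° 16] -/
theorem torus_subset_coordCone (s : Finset (Fin (r + 1))) : torus r ⊆ coordCone s :=
  coordCone_mono (Finset.subset_univ s)

/-- `Û_{0…r}` with `i` inserted is still the torus. [cite: SerreGAGA1956, n° 16] -/
theorem coordCone_insert_univ (i : Fin (r + 1)) :
    coordCone (insert i (Finset.univ : Finset (Fin (r + 1)))) = torus r := by
  rw [Finset.insert_eq_of_mem (Finset.mem_univ i)]; rfl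

/-- The cone of the empty set is everything. [cite: SerreGAGA1956, n° 16] -/
theorem coordCone_empty : coordCone (∅ : Finset (Fin (r + 1))) = univ := by
  ext x; simp [mem_coordCone]

/-- The torus is open. [cite: SerreGAGA1956, n° 16] -/
theorem isOpen_torus : IsOpen (torus r) := isOpen_coordCone _

/-- The torus is stable under nonzero scalars. [cite: SerreGAGA1956, n° 16] -/
theorem smul_mem_torus {x : Fin (r + 1) → ℂ} (hx : x ∈ torus r) {c : ℂ} (hc : c ≠ 0) :
    c • x ∈ torus r :=
  smul_mem_coordCone hx hc

/-- Updating one coordinate of a point of the torus by a nonzero number stays in the torus.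
[cite: SerreGAGA1956, n° 16] -/
theorem update_mem_torus {x : Fin (r + 1) → ℂ} (hx : x ∈ torus r) (i : Fin (r + 1)) {ζ : ℂ}
    (hζ : ζ ≠ 0) : update x i ζ ∈ torus r := by
  rw [mem_torus] at hx ⊢
  intro j
  rcases eq_or_ne j i with rfl | hj
  · rwa [update_self]
  · rw [update_of_ne hj]; exact hx j

/-- A point of the torus lies in `coordCone (univ.erase i)`. [cite: SerreGAGA1956, n° 16] -/
theorem mem_coordCone_erase_of_mem_torus {x : Fin (r + 1) → ℂ} (hx : x ∈ torus r)
    (i : Fin (r + 1)) : x ∈ coordCone ((Finset.univ : Finset (Fin (r + 1))).erase i) :=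
  torus_subset_coordCone _ hx

variable (r) in
/-- **The ambient module `𝕂 = Γ(T, 𝒪)`**: functions on `ℂ^{r+1}` holomorphic on the torus `T` and
vanishing off `T` (so that a member is the extension by zero of its restriction to `T`).
[cite: SerreGAGA1956, n° 13 footnote (4)] -/
def holTorus : Submodule ℂ ((Fin (r + 1) → ℂ) → ℂ) where
  carrier := {f | DifferentiableOn ℂ f (torus r) ∧ ∀ x, x ∉ torus r → f x = 0}
  zero_mem' := ⟨differentiableOn_const 0, fun _ _ => rfl⟩
  add_mem' := fun {f g} hf hg =>
    ⟨hf.1.add hg.1, fun x hx => by simp only [Pi.add_apply, hf.2 x hx, hg.2 x hx, add_zero]⟩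
  smul_mem' := fun a f hf =>
    ⟨hf.1.const_smul a, fun x hx => by simp only [Pi.smul_apply, hf.2 x hx, smul_zero]⟩

/-- Membership in `𝕂`. [cite: SerreGAGA1956, n° 13 footnote (4)] -/
theorem mem_holTorus {f : (Fin (r + 1) → ℂ) → ℂ} :
    f ∈ holTorus r ↔ DifferentiableOn ℂ f (torus r) ∧ ∀ x, x ∉ torus r → f x = 0 := Iff.rfl

/-- The extension by zero of a holomorphic function on `T` lies in `𝕂`.
[cite: SerreGAGA1956, n° 13 footnote (4)] -/
theorem indicator_mem_holTorus {g : (Fin (r + 1) → ℂ) → ℂ} (hg : DifferentiableOn ℂ g (torus r)) :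
    (torus r).indicator g ∈ holTorus r :=
  ⟨hg.congr fun _ hx => indicator_of_mem hx g, fun _ hx => indicator_of_notMem hx g⟩

/-- Two members of `𝕂` agreeing on `T` are equal. [cite: SerreGAGA1956, n° 13 footnote (4)] -/
theorem holTorus_ext {f g : holTorus r}
    (h : ∀ x ∈ torus r, (f : (Fin (r + 1) → ℂ) → ℂ) x = (g : (Fin (r + 1) → ℂ) → ℂ) x) :
    f = g := by
  apply Subtype.ext
  funext x
  by_cases hx : x ∈ torus r
  · exact h x hx
  · rw [f.2.2 x hx, g.2.2 x hx]

/-! ### The holomorphic family `F_n(s) = Γ(U_s^h, 𝒪(n)^h)` -/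

variable (r) in
/-- **The holomorphic sections `F_n(s) = Γ(U_s, 𝒪(n)^h)`** inside `𝕂`: members of `𝕂` which agree on
the torus with a holomorphic function on the cone `Û_s = coordCone s` homogeneous of degree `n`
(Serre's description of `Γ(U, 𝒪(n))` by homogeneous functions on cones, n° 16).
[cite: SerreGAGA1956, n° 16 and n° 13 Lemme 5] -/
def holFamily (n : ℤ) (s : Finset (Fin (r + 1))) : Submodule ℂ (holTorus r) where
  carrier := {f | ∃ g : (Fin (r + 1) → ℂ) → ℂ, DifferentiableOn ℂ g (coordCone s) ∧
    IsHomogeneousOn g n (coordCone s) ∧ EqOn (f : (Fin (r + 1) → ℂ) → ℂ) g (torus r)}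
  zero_mem' := ⟨0, differentiableOn_const 0, fun x _ c _ => by simp, fun _ _ => rfl⟩
  add_mem' := by
    rintro f f' ⟨g, hg, hgh, hfg⟩ ⟨g', hg', hgh', hfg'⟩
    refine ⟨g + g', hg.add hg', fun x hx c hc => ?_, fun x hx => ?_⟩
    · simp only [Pi.add_apply, hgh hx hc, hgh' hx hc, mul_add]
    · simp only [Submodule.coe_add, Pi.add_apply, hfg hx, hfg' hx]
  smul_mem' := by
    rintro a f ⟨g, hg, hgh, hfg⟩
    refine ⟨a • g, hg.const_smul a, fun x hx c hc => ?_, fun x hx => ?_⟩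
    · simp only [Pi.smul_apply, smul_eq_mul, hgh hx hc]; ring
    · simp only [Submodule.coe_smul, Pi.smul_apply, smul_eq_mul, hfg hx]

/-- Membership in `F_n(s)`. [cite: SerreGAGA1956, n° 16] -/
theorem mem_holFamily {n : ℤ} {s : Finset (Fin (r + 1))} {f : holTorus r} :
    f ∈ holFamily r n s ↔ ∃ g : (Fin (r + 1) → ℂ) → ℂ, DifferentiableOn ℂ g (coordCone s) ∧
      IsHomogeneousOn g n (coordCone s) ∧ EqOn (f : (Fin (r + 1) → ℂ) → ℂ) g (torus r) :=
  Iff.rfl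

/-- `s ↦ F_n(s)` is monotone (restriction `Γ(U_s) → Γ(U_t)` for `s ⊆ t`).
[cite: SerreGAGA1956, n° 16] -/
theorem holFamily_mono (n : ℤ) : Monotone (holFamily r n) := by
  rintro s t hst f ⟨g, hg, hgh, hfg⟩
  exact ⟨g, hg.mono (coordCone_mono hst), hgh.mono (coordCone_mono hst), hfg⟩

/-- A member of `F_n({0…r})` is itself homogeneous of degree `n` on the torus.
[cite: SerreGAGA1956, n° 16] -/
theorem isHomogeneousOn_of_mem_holFamily {n : ℤ} {s : Finset (Fin (r + 1))} {f : holTorus r}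
    (hf : f ∈ holFamily r n s) : IsHomogeneousOn (f : (Fin (r + 1) → ℂ) → ℂ) n (torus r) := by
  obtain ⟨g, -, hgh, hfg⟩ := hf
  intro x hx c hc
  rw [hfg hx, hfg (smul_mem_torus hx hc), hgh (torus_subset_coordCone s hx) hc]

/-! ### Laurent polynomials as functions on the torus -/

/-- The Laurent monomial function `x ↦ x^m = ∏_i x_i^{m_i}` (`m ∈ ℤ^{r+1}`; Mathlib's junk value
`0⁻¹ = 0` off the torus). [cite: SerreFAC1955, n° 64] -/
def monoEval (m : Expt r) (x : Fin (r + 1) → ℂ) : ℂ := ∏ i, x i ^ m i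

/-- `x^{m + m'} = x^m x^{m'}` on the torus. [cite: SerreFAC1955, n° 64] -/
theorem monoEval_add {x : Fin (r + 1) → ℂ} (hx : x ∈ torus r) (m m' : Expt r) :
    monoEval (m + m') x = monoEval m x * monoEval m' x := by
  rw [monoEval, monoEval, monoEval, ← Finset.prod_mul_distrib]
  refine Finset.prod_congr rfl fun i _ => ?_
  rw [Pi.add_apply, zpow_add₀ (mem_torus.1 hx i)]

/-- Homogeneity of Laurent monomials: `(c x)^m = c^{|m|} x^m` (`c ≠ 0`).
[cite: SerreFAC1955, n° 64] -/
theorem monoEval_smul (m : Expt r) (x : Fin (r + 1) → ℂ) {c : ℂ} (hc : c ≠ 0) :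
    monoEval m (c • x) = c ^ edeg r m * monoEval m x := by
  rw [monoEval, monoEval, edeg_apply]
  simp only [Pi.smul_apply, smul_eq_mul, mul_zpow, Finset.prod_mul_distrib]
  congr 1
  induction (Finset.univ : Finset (Fin (r + 1))) using Finset.induction_on with
  | empty => simp
  | insert a s ha ih => rw [Finset.prod_insert ha, Finset.sum_insert ha, zpow_add₀ hc, ih]

/-- Laurent monomials with non-negative exponents off `s` are holomorphic on `Û_s`.
[cite: SerreFAC1955, n° 64] -/
theorem differentiableOn_monoEval {m : Expt r} {s : Finset (Fin (r + 1))}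
    (hm : ∀ i, i ∉ s → 0 ≤ m i) : DifferentiableOn ℂ (monoEval m) (coordCone s) := by
  unfold monoEval
  induction (Finset.univ : Finset (Fin (r + 1))) using Finset.induction_on with
  | empty => simp only [Finset.prod_empty]; exact differentiableOn_const _
  | insert a t ha ih =>
    simp only [Finset.prod_insert ha]
    refine DifferentiableOn.mul ?_ ih
    refine ((differentiable_apply (𝕜 := ℂ) a).differentiableOn).zpow ?_
    by_cases has : a ∈ s
    · exact Or.inl fun x hx => (mem_coordCone.1 hx) a has
    · exact Or.inr (hm a has)

/-- **Evaluation of Laurent polynomials** as functions on `ℂ^{r+1}`, a `ℂ`-linear map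
`L = ℂ[x_0^{±1}, …, x_r^{±1}] → (ℂ^{r+1} → ℂ)` (meaningful on the torus).
[cite: SerreFAC1955, n° 64] -/
def lauEval : L ℂ r →ₗ[ℂ] ((Fin (r + 1) → ℂ) → ℂ) where
  toFun v x := v.coeff.sum fun m a => a * monoEval m x
  map_add' v w := by
    funext x
    simp only [AddMonoidAlgebra.coeff_add, Pi.add_apply]
    exact Finsupp.sum_add_index' (fun _ => zero_mul _) fun _ _ _ => add_mul _ _ _
  map_smul' a v := by
    funext x
    simp only [AddMonoidAlgebra.coeff_smul, Pi.smul_apply, smul_eq_mul, RingHom.id_apply]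
    rw [Finsupp.sum_smul_index' (fun _ => zero_mul _), Finsupp.mul_sum]
    simp only [smul_eq_mul, mul_assoc]

/-- Unfolding `lauEval`. [cite: SerreFAC1955, n° 64] -/
theorem lauEval_apply (v : L ℂ r) (x : Fin (r + 1) → ℂ) :
    lauEval v x = v.coeff.sum fun m a => a * monoEval m x := rfl

/-- Evaluation of a monomial. [cite: SerreFAC1955, n° 64] -/
@[simp] theorem lauEval_single (m : Expt r) (a : ℂ) (x : Fin (r + 1) → ℂ) :
    lauEval (AddMonoidAlgebra.single m a) x = a * monoEval m x := by
  rw [lauEval_apply, AddMonoidAlgebra.coeff_single, Finsupp.sum_single_index (zero_mul _)]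

/-- Evaluation of a monomial, as a function. [cite: SerreFAC1955, n° 64] -/
theorem lauEval_single_eq (m : Expt r) (a : ℂ) :
    lauEval (AddMonoidAlgebra.single m a) = a • fun x : Fin (r + 1) → ℂ => ∏ i, x i ^ m i := by
  funext x
  rw [lauEval_single, Pi.smul_apply, smul_eq_mul, monoEval]

/-- Multiplicativity against monomials on the torus: `(x^m · v)(x) = x^m v(x)`.
[cite: SerreFAC1955, n° 64] -/
theorem lauEval_single_mul {x : Fin (r + 1) → ℂ} (hx : x ∈ torus r) (m : Expt r) (v : L ℂ r) :
    lauEval (AddMonoidAlgebra.single m 1 * v) x = monoEval m x * lauEval v x := by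
  induction v using AddMonoidAlgebra.induction_linear with
  | zero => simp
  | add v w hv hw => rw [mul_add, map_add, map_add, Pi.add_apply, Pi.add_apply, hv, hw, mul_add]
  | single m' a =>
    rw [AddMonoidAlgebra.single_mul_single, one_mul, lauEval_single, lauEval_single,
      monoEval_add hx, mul_left_comm]

/-- Evaluation of `x_s^N · v` on the torus. [cite: SerreFAC1955, n° 64] -/
theorem lauEval_xs_mul {x : Fin (r + 1) → ℂ} (hx : x ∈ torus r) (s : Finset (Fin (r + 1)))
    (N : ℤ) (v : L ℂ r) : lauEval (xs ℂ s N * v) x = monoEval (sx r s N) x * lauEval v x :=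
  lauEval_single_mul hx _ v

/-- On the torus, `lauEval (toL p)` is the polynomial function of `p`. [cite: SerreFAC1955, n° 64]
-/
theorem lauEval_toL {x : Fin (r + 1) → ℂ} (hx : x ∈ torus r) (p : P ℂ r) :
    lauEval (toL ℂ r p) x = MvPolynomial.eval x p := by
  induction p using MvPolynomial.induction_on with
  | C a =>
    rw [MvPolynomial.C_apply, toL_monomial, lauEval_single, MvPolynomial.eval_monomial, map_zero,
      monoEval]
    simp
  | add p q hp hq => rw [map_add, map_add, Pi.add_apply, hp, hq, map_add]
  | mul_X p i hp =>
    rw [map_mul, mul_comm, toL_X, lauEval_single_mul hx, hp, map_mul, MvPolynomial.eval_X, mul_comm,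
      monoEval]
    congr 1
    rw [Finset.prod_eq_single i (fun j _ hj => by rw [Pi.single_eq_of_ne hj, zpow_zero])
      (fun h => absurd (Finset.mem_univ i) h), Pi.single_eq_same, zpow_one]

/-- A Laurent polynomial of pure degree `n` evaluates to a function homogeneous of degree `n`.
[cite: SerreFAC1955, n° 64] -/
theorem lauEval_smul_of_mem_Ldeg {n : ℤ} {v : L ℂ r} (hv : v ∈ Ldeg ℂ r n) (x : Fin (r + 1) → ℂ)
    {c : ℂ} (hc : c ≠ 0) : lauEval v (c • x) = c ^ n * lauEval v x := by
  rw [mem_Ldeg] at hv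
  rw [lauEval_apply, lauEval_apply, Finsupp.mul_sum]
  refine Finset.sum_congr rfl fun m hm => ?_
  dsimp only
  rw [monoEval_smul m x hc, hv m (Finsupp.mem_support_iff.1 hm), mul_left_comm]

/-- A Laurent polynomial with non-negative exponents off `s` is holomorphic on `Û_s`.
[cite: SerreFAC1955, n° 64] -/
theorem differentiableOn_lauEval {v : L ℂ r} {s : Finset (Fin (r + 1))}
    (hv : ∀ m, v.coeff m ≠ 0 → ∀ i, i ∉ s → 0 ≤ m i) :
    DifferentiableOn ℂ (lauEval v) (coordCone s) := by
  have : lauEval v = ∑ m ∈ v.coeff.support, fun x => v.coeff m * monoEval m x := by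
    funext x; rw [Finset.sum_apply]; rfl
  rw [this]
  exact DifferentiableOn.sum (u := v.coeff.support) (A := fun m x => v.coeff m * monoEval m x)
    fun m hm => (differentiableOn_monoEval (hv m (Finsupp.mem_support_iff.1 hm))).const_mul _

/-- Laurent polynomials are holomorphic on the torus. [cite: SerreFAC1955, n° 64] -/
theorem differentiableOn_lauEval_torus (v : L ℂ r) : DifferentiableOn ℂ (lauEval v) (torus r) :=
  differentiableOn_lauEval fun _ _ i hi => absurd (Finset.mem_univ i) hi

/-- **Exponent bounds in the localized piece**: if `x_s^N v` is a polynomial, every monomial `x^m`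
of `v` has `m_i ≥ -N [i ∈ s]`. [cite: SerreFAC1955, n° 64] -/
theorem le_of_xs_mul_eq_toL {s : Finset (Fin (r + 1))} {N : ℤ} {v : L ℂ r} {p : P ℂ r}
    (h : xs ℂ s N * v = toL ℂ r p) {m : Expt r} (hm : v.coeff m ≠ 0) (i : Fin (r + 1)) :
    -(sx r s N i) ≤ m i := by
  by_contra hlt
  rw [not_le] at hlt
  have h1 : (xs ℂ s N * v).coeff (sx r s N + m) = v.coeff m := by
    rw [xs, coeff_single_mul, one_mul, add_sub_cancel_left]
  have h2 : (toL ℂ r p).coeff (sx r s N + m) = 0 :=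
    coeff_toL_eq_zero p ⟨i, by rw [Pi.add_apply]; omega⟩
  rw [h, h2] at h1
  exact hm h1.symm

/-- A Laurent polynomial all of whose exponents are non-negative is a polynomial.
[cite: SerreFAC1955, n° 64] -/
theorem exists_toL_eq_of_nonneg {v : L ℂ r} (hv : ∀ m, v.coeff m ≠ 0 → ∀ i, 0 ≤ m i) :
    ∃ p : P ℂ r, toL ℂ r p = v := by
  classical
  refine ⟨v.coeff.sum fun m a =>
    MvPolynomial.monomial (Finsupp.equivFunOnFinite.symm fun i => (m i).toNat) a, ?_⟩
  rw [map_finsuppSum]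
  conv_rhs => rw [← AddMonoidAlgebra.sum_coeff_single v]
  refine Finset.sum_congr rfl fun m hm => ?_
  dsimp only
  rw [toL_monomial]
  congr 1
  ext i
  rw [castExp_apply, Finsupp.coe_equivFunOnFinite_symm,
    Int.toNat_of_nonneg (hv m (Finsupp.mem_support_iff.1 hm) i)]

/-- Every Laurent polynomial becomes a polynomial after multiplication by a power of `x_0 ⋯ x_r`.
[cite: SerreFAC1955, n° 64] -/
theorem exists_xs_univ_mul_eq_toL (v : L ℂ r) :
    ∃ (N : ℕ) (p : P ℂ r), xs ℂ Finset.univ N * v = toL ℂ r p := by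
  classical
  set N : ℕ := v.coeff.support.sup fun m => Finset.univ.sup fun i => (-m i).toNat with hN
  refine ⟨N, ?_⟩
  have key : ∀ m, (xs ℂ Finset.univ N * v).coeff m ≠ 0 → ∀ i, 0 ≤ m i := by
    intro m hm i
    rw [xs, coeff_single_mul, one_mul] at hm
    have hmem : m - sx r Finset.univ N ∈ v.coeff.support := Finsupp.mem_support_iff.2 hm
    have h1 : (-(m - sx r Finset.univ (N : ℤ)) i).toNat ≤ N :=
      le_trans (Finset.le_sup (f := fun i => (-(m - sx r Finset.univ (N : ℤ)) i).toNat)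
        (Finset.mem_univ i)) (Finset.le_sup (f := fun m => Finset.univ.sup fun i => (-m i).toNat)
        hmem)
    have h2 := (Int.toNat_le.1 h1)
    simp only [Pi.sub_apply, sx_apply, Finset.mem_univ, if_true] at h2
    omega
  obtain ⟨p, hp⟩ := exists_toL_eq_of_nonneg key
  exact ⟨p, hp.symm⟩

/-- **Injectivity of evaluation on the torus**: a Laurent polynomial vanishing on `(ℂˣ)^{r+1}` is
zero. [cite: SerreFAC1955, n° 64] -/
theorem eq_zero_of_lauEval_eq_zero {v : L ℂ r} (hv : ∀ x ∈ torus r, lauEval v x = 0) : v = 0 := by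
  obtain ⟨N, p, hp⟩ := exists_xs_univ_mul_eq_toL v
  have hp0 : p = 0 := by
    apply MvPolynomial.funext_set (fun _ : Fin (r + 1) => ({0}ᶜ : Set ℂ))
      (fun _ => (finite_singleton (0 : ℂ)).infinite_compl)
    intro x hx
    have hxT : x ∈ torus r := mem_torus.2 fun i => hx i (mem_univ i)
    rw [map_zero, ← lauEval_toL hxT, ← hp, lauEval_xs_mul hxT, hv x hxT, mul_zero]
  rw [hp0, map_zero] at hp
  have := congrArg (fun w => xs ℂ Finset.univ (-(N : ℤ)) * w) hp
  simp only [← mul_assoc, xs_neg_mul_xs, one_mul, mul_zero] at this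
  exact this

variable (r) in
/-- **Evaluation `ψ : L → 𝕂`**: a Laurent polynomial as a member of `𝕂 = Γ(T, 𝒪)` (its function on
the
torus, extended by zero). [cite: SerreGAGA1956, n° 13 Lemme 5] -/
def holEval : L ℂ r →ₗ[ℂ] holTorus r where
  toFun v :=
    ⟨(torus r).indicator (lauEval v), indicator_mem_holTorus (differentiableOn_lauEval_torus v)⟩
  map_add' v w := by
    apply Subtype.ext
    funext x
    by_cases hx : x ∈ torus r
    · simp [indicator_of_mem hx]
    · simp [indicator_of_notMem hx]
  map_smul' a v := by
    apply Subtype.ext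
    funext x
    by_cases hx : x ∈ torus r
    · simp [indicator_of_mem hx]
    · simp [indicator_of_notMem hx]

/-- The value of `holEval v` on the torus. [cite: SerreGAGA1956, n° 13 Lemme 5] -/
theorem coe_holEval_apply {v : L ℂ r} {x : Fin (r + 1) → ℂ} (hx : x ∈ torus r) :
    (holEval r v : (Fin (r + 1) → ℂ) → ℂ) x = lauEval v x :=
  indicator_of_mem hx _

/-- `holEval` is injective. [cite: SerreGAGA1956, n° 13 Lemme 5] -/
theorem holEval_injective : Function.Injective (holEval r) := by
  intro v w h
  rw [← sub_eq_zero]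
  apply eq_zero_of_lauEval_eq_zero
  intro x hx
  have := congrArg (fun f : holTorus r => (f : (Fin (r + 1) → ℂ) → ℂ) x) h
  simp only [coe_holEval_apply hx] at this
  rw [map_sub, Pi.sub_apply, this, sub_self]

variable (r) in
/-- Evaluation on the one-generator module `𝕂_alg = L^{Unit}` of the tree's `LaurentCech` (the case
`M = P`, one generator of degree `0`, i.e. the sheaves `𝒪(n)`).
[cite: SerreGAGA1956, n° 13 Lemme 5] -/
def ψ : (Unit → L ℂ r) →ₗ[ℂ] holTorus r := holEval r ∘ₗ LinearMap.proj ()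

/-- Unfolding `ψ`. [cite: SerreGAGA1956, n° 13 Lemme 5] -/
@[simp] theorem ψ_apply (v : Unit → L ℂ r) : ψ r v = holEval r (v ()) := rfl

/-! ### The algebraic family `G_n(s)` = evaluations of `LaurentCech.locDeg 0 ⊤ s n` -/

/-- The `P`-module `K = P` (one generator in degree `0`) presenting `𝒪 = 𝒪_{ℙ_r}`: the algebraic
Čech
complex of `𝒪(n)` is `LaurentCech.cech (fun _ : Unit => 0) ⊤ n`. [cite: SerreFAC1955, n° 64] -/
abbrev Ktop (r : ℕ) : Submodule (P ℂ r) (Unit → P ℂ r) := ⊤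

variable (r) in
/-- **The algebraic sections `G_n(s) = Γ(U_s, 𝒪(n))`** inside `𝕂`: evaluations of the Laurent
polynomials of degree `n` with poles only along the `x_i`, `i ∈ s` (`LaurentCech.locDeg`).
[cite: SerreGAGA1956, n° 13 Lemme 5] [cite: SerreFAC1955, n° 64] -/
def algFamily (n : ℤ) (s : Finset (Fin (r + 1))) : Submodule ℂ (holTorus r) :=
  (locDeg (fun _ : Unit => (0 : ℤ)) (Ktop r) s n).map (ψ r)

/-- `s ↦ G_n(s)` is monotone. [cite: SerreFAC1955, n° 64] -/
theorem algFamily_mono (n : ℤ) : Monotone (algFamily r n) :=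
  fun _ _ hst => Submodule.map_mono (locDeg_mono (fun _ : Unit => (0 : ℤ)) (Ktop r) n hst)

/-- Unpacking membership in the localized piece for one generator of degree `0`.
[cite: SerreFAC1955, n° 64] -/
theorem exists_of_mem_locDeg {n : ℤ} {s : Finset (Fin (r + 1))} {v : Unit → L ℂ r}
    (hv : v ∈ locDeg (fun _ : Unit => (0 : ℤ)) (Ktop r) s n) :
    (∃ (N : ℕ) (p : P ℂ r), xs ℂ s N * v () = toL ℂ r p) ∧ v () ∈ Ldeg ℂ r n := by
  rw [mem_locDeg, mem_loc, mem_Kdeg] at hv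
  obtain ⟨⟨N, k, -, hk⟩, hdeg⟩ := hv
  refine ⟨⟨N, k (), ?_⟩, by simpa using hdeg ()⟩
  have := congr_fun hk ()
  rwa [Pi.smul_apply, smul_eq_mul, ιK_apply] at this

/-- Packing membership in the localized piece for one generator of degree `0`.
[cite: SerreFAC1955, n° 64] -/
theorem mem_locDeg_of {n : ℤ} {s : Finset (Fin (r + 1))} {w : L ℂ r} {N : ℕ} {p : P ℂ r}
    (hp : xs ℂ s N * w = toL ℂ r p) (hdeg : w ∈ Ldeg ℂ r n) :
    (fun _ : Unit => w) ∈ locDeg (fun _ : Unit => (0 : ℤ)) (Ktop r) s n := by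
  rw [mem_locDeg, mem_loc, mem_Kdeg]
  refine ⟨⟨N, fun _ => p, trivial, ?_⟩, fun _ => by simpa using hdeg⟩
  funext u
  rw [Pi.smul_apply, smul_eq_mul, ιK_apply, hp]

/-- `G_n(s) ≤ F_n(s)`: a Laurent polynomial of degree `n` with poles along `s` is a holomorphic
homogeneous function on `Û_s`. [cite: SerreGAGA1956, n° 13 Lemme 5] -/
theorem algFamily_le_holFamily (n : ℤ) (s : Finset (Fin (r + 1))) :
    algFamily r n s ≤ holFamily r n s := by
  rintro _ ⟨v, hv, rfl⟩
  obtain ⟨⟨N, p, hp⟩, hdeg⟩ := exists_of_mem_locDeg hv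
  refine ⟨lauEval (v ()), differentiableOn_lauEval fun m hm i hi => ?_,
    fun x _ c hc => lauEval_smul_of_mem_Ldeg hdeg x hc, fun x hx => ?_⟩
  · have := le_of_xs_mul_eq_toL hp hm i
    rw [sx_apply, if_neg hi, neg_zero] at this
    exact this
  · rw [ψ_apply, coe_holEval_apply hx]

/-- The members of `G_n(s)`, concretely. [cite: SerreGAGA1956, n° 13 Lemme 5] -/
theorem holEval_mem_algFamily {n : ℤ} {s : Finset (Fin (r + 1))} {w : L ℂ r} {N : ℕ} {p : P ℂ r}
    (hp : xs ℂ s N * w = toL ℂ r p) (hdeg : w ∈ Ldeg ℂ r n) : holEval r w ∈ algFamily r n s :=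
  ⟨fun _ => w, mem_locDeg_of hp hdeg, rfl⟩

/-! ### The operators `R_i`, `S_i = id - R_i`, `T_i`, `π` on `𝕂` -/

/-- A regular-part congruence: functions agreeing on the torus have the same regular part at points
of the torus (the integration circle `|ζ| = ‖x_i‖ + 1` stays in the torus).
[cite: SerreGAGA1956, n° 13 footnote (4)] -/
theorem regularPart_congr_torus {f g : (Fin (r + 1) → ℂ) → ℂ} (h : EqOn f g (torus r))
    {x : Fin (r + 1) → ℂ} (hx : x ∈ torus r) (i : Fin (r + 1)) :
    regularPart i f x = regularPart i g x := by
  rw [regularPart_def, regularPart_def]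
  congr 1
  refine circleIntegral.integral_congr (by positivity) fun ζ hζ => ?_
  have hζ0 : ζ ≠ 0 := by
    rw [mem_sphere_zero_iff_norm] at hζ
    rw [← norm_pos_iff, hζ]; positivity
  simp only [h (update_mem_torus hx i hζ0)]

/-- Continuity of a member of `𝕂` along the integration circle.
[cite: SerreGAGA1956, n° 13 footnote (4)] -/
theorem continuousOn_sphere_of_mem {f : (Fin (r + 1) → ℂ) → ℂ} (hf : DifferentiableOn ℂ f (torus r))
    {x : Fin (r + 1) → ℂ} (hx : x ∈ torus r) (i : Fin (r + 1)) {R : ℝ} (hR : 0 < R) :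
    ContinuousOn (fun ζ => f (update x i ζ)) (Metric.sphere 0 R) := by
  have hd := differentiableOn_line (s := Finset.univ) (i := i) (f := f)
    (by rw [coordCone_insert_univ]; exact hf) (mem_coordCone_erase_of_mem_torus hx i)
  refine hd.continuousOn.mono fun ζ hζ => ?_
  rw [mem_sphere_zero_iff_norm] at hζ
  rw [mem_compl_iff, mem_singleton_iff]
  rintro rfl
  rw [norm_zero] at hζ
  exact hR.ne' hζ.symm

/-- `R_i` preserves holomorphy on the torus. [cite: SerreGAGA1956, n° 13 footnote (4)] -/
theorem differentiableOn_regularPart_torus {f : (Fin (r + 1) → ℂ) → ℂ}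
    (hf : DifferentiableOn ℂ f (torus r)) (i : Fin (r + 1)) :
    DifferentiableOn ℂ (regularPart i f) (torus r) :=
  (differentiableOn_regularPart (s := Finset.univ) (i := i)
    (by rw [coordCone_insert_univ]; exact hf)).mono (torus_subset_coordCone _)

variable (r) in
/-- **The regular-part operator `R_i` on `𝕂`**: `f ↦ R_i f` (regular part in `x_i`, extended by zero
off the torus). [cite: SerreGAGA1956, n° 13 footnote (4)] -/
def Rop (i : Fin (r + 1)) : holTorus r →ₗ[ℂ] holTorus r where
  toFun f := ⟨(torus r).indicator (regularPart i (f : (Fin (r + 1) → ℂ) → ℂ)),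
    indicator_mem_holTorus (differentiableOn_regularPart_torus f.2.1 i)⟩
  map_add' f g := by
    apply holTorus_ext
    intro x hx
    have hR : (0 : ℝ) < ‖x i‖ + 1 := by positivity
    simp only [Submodule.coe_add, indicator_of_mem hx, Pi.add_apply]
    rw [regularPart, regularPart, regularPart]
    exact regularPartR_add hR.le (by linarith [norm_nonneg (x i)])
      (continuousOn_sphere_of_mem f.2.1 hx i hR) (continuousOn_sphere_of_mem g.2.1 hx i hR)
  map_smul' a f := by
    apply holTorus_ext
    intro x hx
    simp only [Submodule.coe_smul, indicator_of_mem hx, Pi.smul_apply, smul_eq_mul,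
      RingHom.id_apply]
    rw [regularPart, regularPart]
    exact regularPartR_const_smul a _ x

/-- The value of `R_i f` on the torus. [cite: SerreGAGA1956, n° 13 footnote (4)] -/
theorem coe_Rop_apply (i : Fin (r + 1)) (f : holTorus r) {x : Fin (r + 1) → ℂ} (hx : x ∈ torus r) :
    (Rop r i f : (Fin (r + 1) → ℂ) → ℂ) x = regularPart i (f : (Fin (r + 1) → ℂ) → ℂ) x :=
  indicator_of_mem hx _

/-- **`R_i` maps `F_n(s ∪ i)` into `F_n(s ∖ i) ⊆ F_n(s)`** (holomorphic parameters, homogeneity).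
[cite: SerreGAGA1956, n° 13 footnote (4)] -/
theorem Rop_mem_holFamily {n : ℤ} (i : Fin (r + 1)) (s : Finset (Fin (r + 1))) {f : holTorus r}
    (hf : f ∈ holFamily r n (insert i s)) : Rop r i f ∈ holFamily r n s := by
  obtain ⟨g, hg, hgh, hfg⟩ := hf
  have hsub : coordCone s ⊆ coordCone (s.erase i) := coordCone_mono (Finset.erase_subset i s)
  refine ⟨regularPart i g, (differentiableOn_regularPart hg).mono hsub, fun x hx c hc =>
    regularPart_smul hg hgh (hsub hx) hc, fun x hx => ?_⟩
  rw [coe_Rop_apply i f hx]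
  exact regularPart_congr_torus hfg hx i

/-- `R_i` maps `F_n(s)` into itself. [cite: SerreGAGA1956, n° 13 footnote (4)] -/
theorem Rop_mem_holFamily_self {n : ℤ} (i : Fin (r + 1)) (s : Finset (Fin (r + 1))) {f : holTorus r}
    (hf : f ∈ holFamily r n s) : Rop r i f ∈ holFamily r n s :=
  Rop_mem_holFamily i s (holFamily_mono n (Finset.subset_insert i s) hf)

/-- **`R_j` is the identity on `F_n(s)` for `j ∉ s`** (the members are holomorphic across `x_j = 0`;
Cauchy's formula). [cite: SerreGAGA1956, n° 13 footnote (4)] -/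
theorem Rop_eq_self_of_not_mem {n : ℤ} {j : Fin (r + 1)} {s : Finset (Fin (r + 1))} (hj : j ∉ s)
    {f : holTorus r} (hf : f ∈ holFamily r n s) : Rop r j f = f := by
  obtain ⟨g, hg, -, hfg⟩ := hf
  apply holTorus_ext
  intro x hx
  rw [coe_Rop_apply j f hx, regularPart_congr_torus hfg hx j,
    regularPart_eq_self_of_not_mem hj hg (torus_subset_coordCone s hx), hfg hx]

/-- The positive part of a Laurent polynomial in the variable `x_i`: the monomials with `m_i ≥ 0`.
[cite: SerreGAGA1956, n° 13 footnote (4)] -/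
def posPart (i : Fin (r + 1)) (v : L ℂ r) : L ℂ r :=
  AddMonoidAlgebra.ofCoeff (v.coeff.filter fun m => 0 ≤ m i)

/-- Coefficients of the positive part. [cite: SerreGAGA1956, n° 13 footnote (4)] -/
theorem coeff_posPart (i : Fin (r + 1)) (v : L ℂ r) (m : Expt r) :
    (posPart i v).coeff m = if 0 ≤ m i then v.coeff m else 0 := by
  rw [posPart, AddMonoidAlgebra.coeff_ofCoeff, Finsupp.filter_apply]

/-- `posPart i` is additive. [cite: SerreGAGA1956, n° 13 footnote (4)] -/
theorem posPart_add (i : Fin (r + 1)) (v w : L ℂ r) :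
    posPart i (v + w) = posPart i v + posPart i w := by
  apply AddMonoidAlgebra.ext
  ext m
  simp only [coeff_posPart, AddMonoidAlgebra.coeff_add, Finsupp.add_apply]
  split_ifs <;> simp

/-- `posPart i` of a monomial. [cite: SerreGAGA1956, n° 13 footnote (4)] -/
theorem posPart_single (i : Fin (r + 1)) (m : Expt r) (a : ℂ) :
    posPart i (AddMonoidAlgebra.single m a) =
      if 0 ≤ m i then AddMonoidAlgebra.single m a else 0 := by
  apply AddMonoidAlgebra.ext
  ext m'
  rw [coeff_posPart, AddMonoidAlgebra.coeff_single]
  by_cases h : m = m'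
  · subst h
    split_ifs <;> simp
  · rw [Finsupp.single_apply, if_neg h, ite_self]
    split_ifs
    · rw [AddMonoidAlgebra.coeff_single, Finsupp.single_apply, if_neg h]
    · rfl

/-- **`R_i` on Laurent polynomials is the positive part in `x_i`** (`R_i x^m = [m_i ≥ 0] x^m`).
[cite: SerreGAGA1956, n° 13 footnote (4)] -/
theorem regularPart_lauEval (i : Fin (r + 1)) (v : L ℂ r) {x : Fin (r + 1) → ℂ} (hx : x ∈ torus r) :
    regularPart i (lauEval v) x = lauEval (posPart i v) x := by
  have hR : (0 : ℝ) < ‖x i‖ + 1 := by positivity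
  induction v using AddMonoidAlgebra.induction_linear with
  | zero =>
    rw [posPart]
    simp only [map_zero, AddMonoidAlgebra.coeff_zero, Finsupp.filter_zero,
      AddMonoidAlgebra.ofCoeff_zero, Pi.zero_apply]
    have : regularPart i ((0 : ℂ) • (0 : (Fin (r + 1) → ℂ) → ℂ)) x = 0 := by
      rw [regularPart, regularPartR_const_smul, zero_mul]
    simpa using this
  | add v w hv hw =>
    rw [posPart_add, map_add, map_add, Pi.add_apply, ← hv, ← hw, regularPart, regularPart,
      regularPart]
    exact regularPartR_add hR.le (by linarith [norm_nonneg (x i)])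
      (continuousOn_sphere_of_mem (differentiableOn_lauEval_torus v) hx i hR)
      (continuousOn_sphere_of_mem (differentiableOn_lauEval_torus w) hx i hR)
  | single m a =>
    rw [lauEval_single_eq, regularPart, regularPartR_const_smul, ← regularPart,
      regularPart_monomial, posPart_single]
    split_ifs with h
    · rw [lauEval_single, monoEval]
    · rw [map_zero, Pi.zero_apply, mul_zero]

/-- `R_i ∘ ψ = ψ ∘ posPart_i`. [cite: SerreGAGA1956, n° 13 footnote (4)] -/
theorem Rop_holEval (i : Fin (r + 1)) (v : L ℂ r) :
    Rop r i (holEval r v) = holEval r (posPart i v) := by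
  apply holTorus_ext
  intro x hx
  rw [coe_Rop_apply i _ hx, coe_holEval_apply hx, ← regularPart_lauEval i v hx]
  exact regularPart_congr_torus (fun y hy => coe_holEval_apply hy) hx i

/-- The positive part preserves the degree-`n` piece. [cite: SerreFAC1955, n° 64] -/
theorem posPart_mem_Ldeg {n : ℤ} (i : Fin (r + 1)) {v : L ℂ r} (hv : v ∈ Ldeg ℂ r n) :
    posPart i v ∈ Ldeg ℂ r n := by
  rw [mem_Ldeg] at hv ⊢
  intro m hm
  rw [coeff_posPart] at hm
  split_ifs at hm with h
  · exact hv m hm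
  · exact absurd rfl hm

/-- **`R_i` maps `G_n(s ∪ i)` into `G_n(s)`**: the positive part in `x_i` of a Laurent polynomial
with
poles along `s ∪ i` has poles along `s` only. [cite: SerreGAGA1956, n° 13 footnote (4)] -/
theorem Rop_mem_algFamily {n : ℤ} (i : Fin (r + 1)) (s : Finset (Fin (r + 1))) {f : holTorus r}
    (hf : f ∈ algFamily r n (insert i s)) : Rop r i f ∈ algFamily r n s := by
  obtain ⟨v, hv, rfl⟩ := hf
  obtain ⟨⟨N, p, hp⟩, hdeg⟩ := exists_of_mem_locDeg hv
  rw [ψ_apply, Rop_holEval]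
  obtain ⟨q, hq⟩ := exists_toL_eq_of_nonneg (v := xs ℂ s N * posPart i (v ())) fun m hm c => by
    rw [xs, coeff_single_mul, one_mul, coeff_posPart] at hm
    split_ifs at hm with h
    · have hb := le_of_xs_mul_eq_toL hp hm c
      simp only [Pi.sub_apply, sx_apply, Finset.mem_insert] at hb h
      by_cases hcs : c ∈ s
      · simp only [hcs, if_true, or_true] at hb
        omega
      · by_cases hci : c = i
        · subst hci
          simp only [hcs, if_false, sub_zero] at h
          exact h
        · simp only [hcs, hci, if_false, or_self, neg_zero, sub_zero] at hb
          exact hb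
    · exact absurd rfl hm
  exact holEval_mem_algFamily hq.symm (posPart_mem_Ldeg i hdeg)

/-- `R_i` maps `G_n(s)` into itself. [cite: SerreGAGA1956, n° 13 footnote (4)] -/
theorem Rop_mem_algFamily_self {n : ℤ} (i : Fin (r + 1)) (s : Finset (Fin (r + 1))) {f : holTorus r}
    (hf : f ∈ algFamily r n s) : Rop r i f ∈ algFamily r n s :=
  Rop_mem_algFamily i s (algFamily_mono n (Finset.subset_insert i s) hf)

variable (r) in
/-- `S_i = id - R_i` (minus the principal part in `x_i`). [cite: SerreGAGA1956, n° 13 footnote (4)]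
-/
def Sop (i : Fin (r + 1)) : holTorus r →ₗ[ℂ] holTorus r := LinearMap.id - Rop r i

variable (r) in
/-- `S_k` for a natural-number index (`id` for `k > r`). [cite: SerreGAGA1956, n° 13 footnote (4)]
-/
def SopN (k : ℕ) : holTorus r →ₗ[ℂ] holTorus r :=
  if h : k < r + 1 then Sop r ⟨k, h⟩ else LinearMap.id

variable (r) in
/-- The prefix products `P_k = S_0 ∘ S_1 ∘ ⋯ ∘ S_{k-1}` (`P_0 = id`).
[cite: SerreGAGA1956, n° 13 footnote (4)] -/
def Pop : ℕ → (holTorus r →ₗ[ℂ] holTorus r)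
  | 0 => LinearMap.id
  | k + 1 => Pop k ∘ₗ SopN r k

variable (r) in
/-- The suffix products `Q_b = S_{r+1-b} ∘ ⋯ ∘ S_r` (`b` factors; `Q_0 = id`).
[cite: SerreGAGA1956, n° 13 footnote (4)] -/
def Qop : ℕ → (holTorus r →ₗ[ℂ] holTorus r)
  | 0 => LinearMap.id
  | b + 1 => SopN r (r - b) ∘ₗ Qop b

variable (r) in
/-- **The twisted cone operators `T_i = S_0 ∘ ⋯ ∘ S_{i-1} ∘ R_i`.**
[cite: SerreGAGA1956, n° 13 footnote (4)] -/
def Top (i : Fin (r + 1)) : holTorus r →ₗ[ℂ] holTorus r := Pop r i ∘ₗ Rop r i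

variable (r) in
/-- **The projector `π = S_0 ∘ ⋯ ∘ S_r`** onto "no principal parts" (on `F({0…r})`: onto the Laurent
polynomials, Lemme 4). [cite: SerreGAGA1956, n° 13 footnote (4)] -/
def πop : holTorus r →ₗ[ℂ] holTorus r := Pop r (r + 1)

/-- A submodule stable under all `R_i` is stable under all `S_k`.
[cite: SerreGAGA1956, n° 13 footnote (4)] -/
theorem SopN_mem {M : Submodule ℂ (holTorus r)} (hM : ∀ i, ∀ f ∈ M, Rop r i f ∈ M) (k : ℕ)
    {f : holTorus r} (hf : f ∈ M) : SopN r k f ∈ M := by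
  unfold SopN
  split_ifs with h
  · rw [Sop, LinearMap.sub_apply, LinearMap.id_apply]
    exact M.sub_mem hf (hM _ f hf)
  · exact hf

/-- A submodule stable under all `R_i` is stable under all `P_k`.
[cite: SerreGAGA1956, n° 13 footnote (4)] -/
theorem Pop_mem {M : Submodule ℂ (holTorus r)} (hM : ∀ i, ∀ f ∈ M, Rop r i f ∈ M) (k : ℕ)
    {f : holTorus r} (hf : f ∈ M) : Pop r k f ∈ M := by
  induction k generalizing f with
  | zero => exact hf
  | succ k ih => exact ih (SopN_mem hM k hf)

/-- A submodule stable under all `R_i` is stable under all `Q_b`.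
[cite: SerreGAGA1956, n° 13 footnote (4)] -/
theorem Qop_mem {M : Submodule ℂ (holTorus r)} (hM : ∀ i, ∀ f ∈ M, Rop r i f ∈ M) (b : ℕ)
    {f : holTorus r} (hf : f ∈ M) : Qop r b f ∈ M := by
  induction b with
  | zero => exact hf
  | succ b ih => exact SopN_mem hM _ ih

/-- `T_i (F_n(s ∪ i)) ⊆ F_n(s)`. [cite: SerreGAGA1956, n° 13 footnote (4)] -/
theorem Top_mem_holFamily (n : ℤ) (i : Fin (r + 1)) (s : Finset (Fin (r + 1))) :
    ∀ f ∈ holFamily r n (insert i s), Top r i f ∈ holFamily r n s := fun _ hf =>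
  Pop_mem (fun j _ hg => Rop_mem_holFamily_self j s hg) i (Rop_mem_holFamily i s hf)

/-- `T_i (G_n(s ∪ i)) ⊆ G_n(s)`. [cite: SerreGAGA1956, n° 13 footnote (4)] -/
theorem Top_mem_algFamily (n : ℤ) (i : Fin (r + 1)) (s : Finset (Fin (r + 1))) :
    ∀ f ∈ algFamily r n (insert i s), Top r i f ∈ algFamily r n s := fun _ hf =>
  Pop_mem (fun j _ hg => Rop_mem_algFamily_self j s hg) i (Rop_mem_algFamily i s hf)

/-- `P_0 = id`. [cite: SerreGAGA1956, n° 13 footnote (4)] -/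
@[simp] theorem Pop_zero : Pop r 0 = LinearMap.id := rfl

/-- `P_{k+1} = P_k ∘ S_k`. [cite: SerreGAGA1956, n° 13 footnote (4)] -/
theorem Pop_succ (k : ℕ) : Pop r (k + 1) = Pop r k ∘ₗ SopN r k := rfl

/-- `Q_0 = id`. [cite: SerreGAGA1956, n° 13 footnote (4)] -/
@[simp] theorem Qop_zero : Qop r 0 = LinearMap.id := rfl

/-- `Q_{b+1} = S_{r-b} ∘ Q_b`. [cite: SerreGAGA1956, n° 13 footnote (4)] -/
theorem Qop_succ (b : ℕ) : Qop r (b + 1) = SopN r (r - b) ∘ₗ Qop r b := rfl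

/-- Telescoping in an additive group. [folklore] -/
private theorem sum_range_telescope {G : Type*} [AddCommGroup G] (f : ℕ → G) (n : ℕ) :
    ∑ k ∈ Finset.range n, (f k - f (k + 1)) = f 0 - f n := by
  induction n with
  | zero => simp
  | succ n ih => rw [Finset.sum_range_succ, ih, sub_add_sub_cancel]

/-- `P_k ∘ R_k = P_k - P_{k+1}` (`k ≤ r`). [cite: SerreGAGA1956, n° 13 footnote (4)] -/
theorem Pop_comp_Rop (i : Fin (r + 1)) : Pop r i ∘ₗ Rop r i = Pop r i - Pop r (i + 1) := by
  rw [Pop_succ, SopN, dif_pos i.2, Fin.eta, Sop, LinearMap.comp_sub, LinearMap.comp_id]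
  exact (sub_sub_cancel (Pop r i) (Pop r i ∘ₗ Rop r i)).symm

/-- **`Σ_i T_i + π = id`** (telescoping). [cite: SerreGAGA1956, n° 13 footnote (4)] -/
theorem sum_Top_add_πop : ∑ i, Top r i + πop r = LinearMap.id := by
  have h1 : ∑ i : Fin (r + 1), Top r i = ∑ k ∈ Finset.range (r + 1), (Pop r k - Pop r (k + 1)) := by
    rw [← Fin.sum_univ_eq_sum_range (fun k => Pop r k - Pop r (k + 1)) (r + 1)]
    exact Finset.sum_congr rfl fun i _ => Pop_comp_Rop i
  have h2 : ∑ k ∈ Finset.range (r + 1), (Pop r k - Pop r (k + 1)) = Pop r 0 - Pop r (r + 1) :=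
    sum_range_telescope (Pop r) (r + 1)
  rw [h1, h2, πop, Pop_zero]
  exact sub_add_cancel LinearMap.id (Pop r (r + 1))

/-- `Σ_i T_i f + π f = f`. [cite: SerreGAGA1956, n° 13 footnote (4)] -/
theorem sum_Top_add_πop_apply (f : holTorus r) : ∑ i, Top r i f + πop r f = f := by
  have := congrArg (fun φ : holTorus r →ₗ[ℂ] holTorus r => φ f) (sum_Top_add_πop (r := r))
  simpa only [LinearMap.add_apply, LinearMap.sum_apply, LinearMap.id_apply] using this

/-- `π = P_{r+1-b} ∘ Q_b` (`b ≤ r + 1`). [cite: SerreGAGA1956, n° 13 footnote (4)] -/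
theorem πop_eq_Pop_comp_Qop {b : ℕ} (hb : b ≤ r + 1) : πop r = Pop r (r + 1 - b) ∘ₗ Qop r b := by
  induction b with
  | zero => rw [Qop_zero, LinearMap.comp_id, Nat.sub_zero, πop]
  | succ b ih =>
    rw [ih (Nat.le_of_succ_le hb), Qop_succ, ← LinearMap.comp_assoc]
    congr 1
    obtain ⟨k, hk⟩ : ∃ k, r + 1 - b = k + 1 := ⟨r - b, by omega⟩
    rw [hk, Pop_succ, show r + 1 - (b + 1) = k by omega, show r - b = k by omega]

/-- `π = Q_{r+1}`: `π = S_0 ∘ (S_1 ∘ ⋯ (S_r))`. [cite: SerreGAGA1956, n° 13 footnote (4)] -/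
theorem πop_eq_Qop : πop r = Qop r (r + 1) := by
  rw [πop_eq_Pop_comp_Qop le_rfl, Nat.sub_self, Pop_zero, LinearMap.id_comp]

/-- **`π` kills `F_n(s)` for `s ≠ {0, …, r}`** (`S_j F_n(s) = 0` for `j ∉ s`), in particular
`π (F_n s) ⊆ G_n(s)` for such `s`. [cite: SerreGAGA1956, n° 13 footnote (4)] -/
theorem πop_eq_zero_of_not_mem {n : ℤ} {j : Fin (r + 1)} {s : Finset (Fin (r + 1))} (hj : j ∉ s)
    {f : holTorus r} (hf : f ∈ holFamily r n s) : πop r f = 0 := by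
  rw [πop_eq_Pop_comp_Qop (show r - (j : ℕ) + 1 ≤ r + 1 by omega), LinearMap.comp_apply, Qop_succ,
    LinearMap.comp_apply, show r - (r - (j : ℕ)) = j by omega, SopN, dif_pos j.2, Sop,
    LinearMap.sub_apply, LinearMap.id_apply, Fin.eta,
    Rop_eq_self_of_not_mem hj (Qop_mem (fun i _ hg => Rop_mem_holFamily_self i s hg) _ hf),
    sub_self, map_zero]

/-! ### Entire homogeneous functions are homogeneous polynomials (Liouville) -/

/-- Homogeneous polynomials are homogeneous functions: `q(c z) = c^d q(z)`.
[cite: SerreFAC1955, n° 64] -/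
theorem eval_smul_of_isHomogeneous {q : P ℂ r} {d : ℕ} (hq : q.IsHomogeneous d) (c : ℂ)
    (z : Fin (r + 1) → ℂ) : MvPolynomial.eval (c • z) q = c ^ d * MvPolynomial.eval z q := by
  rw [MvPolynomial.eval_eq', MvPolynomial.eval_eq', Finset.mul_sum]
  refine Finset.sum_congr rfl fun m hm => ?_
  have hdeg : ∑ i, m i = d := by
    have h := hq (MvPolynomial.mem_support_iff.1 hm)
    rw [weight_one_apply, Finsupp.degree_eq_sum] at h
    exact h
  simp only [Pi.smul_apply, smul_eq_mul, mul_pow, Finset.prod_mul_distrib,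
    Finset.prod_pow_eq_pow_sum, hdeg]
  ring

/-- **Extraction of the homogeneous component**: if the polynomial function `p` is homogeneous of
degree `d` as a function (`p(cz) = c^d p(z)`, `c ≠ 0`), then `p` agrees with its degree-`d`
homogeneous component (compare coefficients of the one-variable polynomial `c ↦ p(cz) - c^d p(z)`,
which has infinitely many roots). [cite: SerreGAGA1956, n° 13 Lemme 4] -/
theorem eval_homogeneousComponent_eq {p : P ℂ r} {G : (Fin (r + 1) → ℂ) → ℂ}
    (hp : ∀ z, MvPolynomial.eval z p = G z) {d : ℕ}
    (hhom : ∀ z : Fin (r + 1) → ℂ, ∀ c : ℂ, c ≠ 0 → G (c • z) = c ^ (d : ℤ) * G z)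
    (z : Fin (r + 1) → ℂ) : MvPolynomial.eval z (MvPolynomial.homogeneousComponent d p) = G z := by
  classical
  set N := p.totalDegree with hN
  set e : ℕ → ℂ := fun j => MvPolynomial.eval z (MvPolynomial.homogeneousComponent j p) with he
  set Q : Polynomial ℂ := ∑ j ∈ Finset.range (N + 1), Polynomial.C (e j) * Polynomial.X ^ j -
    Polynomial.C (G z) * Polynomial.X ^ d with hQ
  have hroot : ∀ c : ℂ, c ≠ 0 → Q.IsRoot c := by
    intro c hc
    have h1 : MvPolynomial.eval (c • z) p = ∑ j ∈ Finset.range (N + 1), e j * c ^ j := by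
      conv_lhs => rw [← MvPolynomial.sum_homogeneousComponent p]
      rw [map_sum]
      refine Finset.sum_congr rfl fun j _ => ?_
      rw [eval_smul_of_isHomogeneous (MvPolynomial.homogeneousComponent_isHomogeneous j p) c z,
        mul_comm]
    have h2 := hhom z c hc
    rw [← hp (c • z), h1, zpow_natCast] at h2
    simp only [Polynomial.IsRoot, hQ, Polynomial.eval_sub, Polynomial.eval_finsetSum,
      Polynomial.eval_mul, Polynomial.eval_C, Polynomial.eval_pow, Polynomial.eval_X, h2]
    ring
  have hQ0 : Q = 0 :=
    Polynomial.eq_zero_of_infinite_isRoot Q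
      (((finite_singleton (0 : ℂ)).infinite_compl).mono fun c hc => hroot c hc)
  have hcoeff := congrArg (fun P : Polynomial ℂ => P.coeff d) hQ0
  simp only [hQ, Polynomial.coeff_sub, Polynomial.finsetSum_coeff, Polynomial.coeff_C_mul_X_pow,
    Polynomial.coeff_zero, Finset.sum_ite_eq, if_true, sub_eq_zero] at hcoeff
  by_cases hd : d ∈ Finset.range (N + 1)
  · rw [if_pos hd] at hcoeff
    exact hcoeff
  · rw [if_neg hd] at hcoeff
    rw [MvPolynomial.homogeneousComponent_eq_zero d p
      (by rw [Finset.mem_range, not_lt] at hd; omega), map_zero]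
    exact hcoeff

/-- **Entire functions homogeneous of an integer degree `K` are homogeneous polynomials of degree
`K`** (and vanish if `K < 0`): polynomial growth from homogeneity and compactness of the unit
sphere, Liouville (`Literature.Analysis.Complex.exists_mvPolynomial_of_growth_of_one_le_norm`), and
extraction of the
homogeneous component. This is the mechanism of Serre's Lemme 4 (and of `F ∅ = G ∅`).
[cite: SerreGAGA1956, n° 13 Lemme 4] -/
theorem exists_mvPolynomial_of_homogeneous {G : (Fin (r + 1) → ℂ) → ℂ} (hG : Differentiable ℂ G)
    {K : ℤ} (hhom : ∀ z : Fin (r + 1) → ℂ, ∀ c : ℂ, c ≠ 0 → G (c • z) = c ^ K * G z) :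
    ∃ q : P ℂ r, (∀ z, MvPolynomial.eval z q = G z) ∧ toL ℂ r q ∈ Ldeg ℂ r K := by
  obtain ⟨M, hM⟩ : ∃ M, ∀ z ∈ Metric.sphere (0 : Fin (r + 1) → ℂ) 1, ‖G z‖ ≤ M :=
    (isCompact_sphere 0 1).exists_bound_of_continuousOn hG.continuous.continuousOn
  have hbound : ∀ z : Fin (r + 1) → ℂ, 1 ≤ ‖z‖ → ‖G z‖ ≤ max M 0 * ‖z‖ ^ K := by
    intro z hz
    have hz0' : ‖z‖ ≠ 0 := by linarith
    have hz0 : ((‖z‖ : ℝ) : ℂ) ≠ 0 := by exact_mod_cast hz0'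
    set u : Fin (r + 1) → ℂ := ((‖z‖ : ℝ) : ℂ)⁻¹ • z with hu
    have hu1 : u ∈ Metric.sphere (0 : Fin (r + 1) → ℂ) 1 := by
      rw [mem_sphere_zero_iff_norm, hu, norm_smul, norm_inv, Complex.norm_real, Real.norm_eq_abs,
        abs_of_nonneg (norm_nonneg z), inv_mul_cancel₀ hz0']
    have hzu : z = ((‖z‖ : ℝ) : ℂ) • u := by rw [hu, smul_smul, mul_inv_cancel₀ hz0, one_smul]
    have hGz : G z = ((‖z‖ : ℝ) : ℂ) ^ K * G u := by
      conv_lhs => rw [hzu]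
      exact hhom u _ hz0
    rw [hGz, norm_mul, norm_zpow, Complex.norm_real, Real.norm_eq_abs,
      abs_of_nonneg (norm_nonneg z), mul_comm]
    exact mul_le_mul_of_nonneg_right ((hM u hu1).trans (le_max_left _ _))
      (zpow_nonneg (norm_nonneg _) _)
  rcases le_or_gt 0 K with hK | hK
  · obtain ⟨d, rfl⟩ : ∃ d : ℕ, K = d := ⟨K.toNat, (Int.toNat_of_nonneg hK).symm⟩
    obtain ⟨p, -, hp⟩ :=
      Literature.Analysis.Complex.exists_mvPolynomial_of_growth_of_one_le_norm hG (C := max M 0)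
        (K := d) (fun z hz => by have := hbound z hz; rwa [zpow_natCast] at this)
    exact ⟨MvPolynomial.homogeneousComponent d p, eval_homogeneousComponent_eq hp hhom,
      (toL_mem_Ldeg_iff _ d).2 (MvPolynomial.homogeneousComponent_isHomogeneous d p)⟩
  · -- negative degree: `G` is bounded, hence constant, hence `0`
    obtain ⟨p, hp0, hp⟩ :=
      Literature.Analysis.Complex.exists_mvPolynomial_of_growth_of_one_le_norm hG (C := max M 0)
        (K := 0) (fun z hz => (hbound z hz).trans (by
        rw [pow_zero]
        exact mul_le_mul_of_nonneg_left ((zpow_le_one_of_nonpos₀ hz hK.le).trans (le_refl 1))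
          (le_max_right _ _)))
    have hpC : p = MvPolynomial.C (p.coeff 0) :=
      MvPolynomial.totalDegree_eq_zero_iff_eq_C.1 (Nat.le_zero.1 hp0)
    have hconst : ∀ z, G z = G 0 := by
      intro z
      rw [← hp z, ← hp 0, hpC, MvPolynomial.eval_C, MvPolynomial.eval_C]
    have hG0 : G 0 = 0 := by
      have h2 := hhom 0 2 two_ne_zero
      rw [smul_zero] at h2
      have hne : (2 : ℂ) ^ K ≠ 1 := by
        intro h
        have := congrArg norm h
        rw [norm_zpow, norm_one, RCLike.norm_ofNat] at this
        exact (zpow_lt_one_of_neg₀ (by norm_num : (1 : ℝ) < 2) hK).ne this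
      have h3 : (1 - (2 : ℂ) ^ K) * G 0 = 0 := by rw [sub_mul, one_mul, ← h2, sub_self]
      rcases mul_eq_zero.1 h3 with h | h
      · exact absurd (sub_eq_zero.1 h).symm hne
      · exact h
    refine ⟨0, fun z => ?_, by rw [map_zero]; exact Submodule.zero_mem _⟩
    rw [map_zero, hconst z, hG0]

/-- **`F_n(∅) ≤ G_n(∅)`**: an entire function on `ℂ^{r+1}` homogeneous of degree `n` is a
homogeneous
polynomial of degree `n`. [cite: SerreGAGA1956, n° 13 Lemme 5] -/
theorem holFamily_empty_le (n : ℤ) : holFamily r n ∅ ≤ algFamily r n ∅ := by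
  rintro f ⟨g, hg, hgh, hfg⟩
  rw [coordCone_empty] at hg hgh
  obtain ⟨q, hq, hdeg⟩ := exists_mvPolynomial_of_homogeneous (differentiableOn_univ.1 hg)
    (fun z c hc => hgh (mem_univ z) hc)
  have hmem : holEval r (toL ℂ r q) ∈ algFamily r n ∅ :=
    holEval_mem_algFamily (N := 0) (p := q) (by rw [Nat.cast_zero, xs_zero, one_mul]) hdeg
  have hfeq : f = holEval r (toL ℂ r q) :=
    holTorus_ext fun x hx => by rw [coe_holEval_apply hx, lauEval_toL hx, hq, hfg hx]
  rw [hfeq]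
  exact hmem

/-! ### Lemme 4: `π (F_n({0…r})) ⊆ G_n({0…r})` (several-variable Laurent separation) -/

/-- The value of `S_k g` on the torus: `g - R_k g`. [cite: SerreGAGA1956, n° 13 footnote (4)] -/
theorem coe_SopN_apply {k : ℕ} (hk : k < r + 1) (g : holTorus r) {x : Fin (r + 1) → ℂ}
    (hx : x ∈ torus r) : (SopN r k g : (Fin (r + 1) → ℂ) → ℂ) x =
      (g : (Fin (r + 1) → ℂ) → ℂ) x - regularPart ⟨k, hk⟩ (g : (Fin (r + 1) → ℂ) → ℂ) x := by
  rw [SopN, dif_pos hk, Sop, LinearMap.sub_apply, LinearMap.id_apply, Submodule.coe_sub,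
    Pi.sub_apply, coe_Rop_apply _ g hx]

/-- **The iterated principal-part bound.** If `|f| ≤ C` on the circles `|y_c| = ε` in the last `b`
coordinates (the first coordinates frozen at those of `x`), and `‖x_c‖ ≥ 2ε` in the last `b`
coordinates, then `|Q_b f (x)| ≤ C`: each `S_c = id - R_c` is the principal part in `x_c`, a Cauchy
integral over `|ζ| = ε` bounded by `ε (‖x_c‖ - ε)⁻¹ sup ≤ sup`.
[cite: SerreGAGA1956, n° 13 Lemme 4] -/
theorem norm_Qop_le (f : holTorus r) {ε C : ℝ} (hε : 0 < ε) :
    ∀ b, b ≤ r + 1 → ∀ x ∈ torus r, (∀ c : Fin (r + 1), r + 1 ≤ c.val + b → 2 * ε ≤ ‖x c‖) →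
      (∀ y ∈ torus r, (∀ c : Fin (r + 1), c.val + b < r + 1 → y c = x c) →
        (∀ c : Fin (r + 1), r + 1 ≤ c.val + b → ‖y c‖ = ε) → ‖(f : (Fin (r + 1) → ℂ) → ℂ) y‖ ≤ C) →
      ‖(Qop r b f : (Fin (r + 1) → ℂ) → ℂ) x‖ ≤ C := by
  intro b
  induction b with
  | zero =>
    intro _ x hx _ hC
    rw [Qop_zero, LinearMap.id_apply]
    exact hC x hx (fun c _ => rfl) (fun c hc => absurd hc (by have := c.2; omega))
  | succ b ih =>
    intro hb x hx hεx hC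
    have hb' : b ≤ r + 1 := Nat.le_of_succ_le hb
    have hjlt : r - b < r + 1 := by omega
    set j : Fin (r + 1) := ⟨r - b, hjlt⟩ with hj
    have hjv : (j : ℕ) = r - b := rfl
    have hεj : 2 * ε ≤ ‖x j‖ := hεx j (by rw [hjv]; omega)
    rw [Qop_succ, LinearMap.comp_apply, coe_SopN_apply hjlt _ hx]
    -- the bound on the small circle in the coordinate `j`, from the induction hypothesis
    have hcirc : ∀ ζ : ℂ, ‖ζ‖ = ε →
        ‖(Qop r b f : (Fin (r + 1) → ℂ) → ℂ) (update x j ζ)‖ ≤ C := by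
      intro ζ hζ
      have hζ0 : ζ ≠ 0 := by
        rintro rfl
        rw [norm_zero] at hζ
        exact hε.ne' hζ.symm
      refine ih hb' (update x j ζ) (update_mem_torus hx j hζ0) (fun c hc => ?_) fun y hy h1 h2 => ?_
      · have hcj : c ≠ j := fun h => by rw [h, hjv] at hc; omega
        rw [update_of_ne hcj]
        exact hεx c (by omega)
      · refine hC y hy (fun c hc => ?_) fun c hc => ?_
        · have hcj : c ≠ j := fun h => by rw [h, hjv] at hc; omega
          rw [h1 c (by omega), update_of_ne hcj]
        · rcases (show r + 1 ≤ c.val + b ∨ c.val + b = r by omega) with h | h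
          · exact h2 c h
          · have hcj : c = j := Fin.ext (by rw [hjv]; omega)
            rw [h1 c (by omega), hcj, update_self, hζ]
    have hd :
        DifferentiableOn ℂ (fun ζ => (Qop r b f : (Fin (r + 1) → ℂ) → ℂ) (update x j ζ)) {0}ᶜ :=
      differentiableOn_line (s := Finset.univ)
        (by rw [coordCone_insert_univ]; exact (Qop r b f).2.1)
        (mem_coordCone_erase_of_mem_torus hx j)
    have key := norm_sub_regularPart_le hd hε (by linarith) hcirc
    refine key.trans ?_
    -- `ε (‖x_j‖ - ε)⁻¹ C ≤ C`
    have hC0 : 0 ≤ C := le_trans (norm_nonneg _) (hcirc ε (by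
      rw [Complex.norm_real, Real.norm_eq_abs, abs_of_pos hε]))
    have h1 : ε * (‖x j‖ - ε)⁻¹ ≤ 1 := by
      rw [← div_eq_mul_inv, div_le_one (by linarith)]
      linarith
    calc ε * ((‖x j‖ - ε)⁻¹ * C) = ε * (‖x j‖ - ε)⁻¹ * C := by ring
      _ ≤ 1 * C := mul_le_mul_of_nonneg_right h1 hC0
      _ = C := one_mul C

/-- A bound for a member of `𝕂` on the compact torus `{‖y_c‖ = ε ∀ c} ⊂ T`.
[cite: SerreGAGA1956, n° 13 Lemme 4] -/
theorem exists_bound_on_torus (f : holTorus r) {ε : ℝ} (hε : 0 < ε) :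
    ∃ C, ∀ y ∈ torus r, (∀ c : Fin (r + 1), ‖y c‖ = ε) → ‖(f : (Fin (r + 1) → ℂ) → ℂ) y‖ ≤ C := by
  have hK : IsCompact (Set.pi univ fun _ : Fin (r + 1) => Metric.sphere (0 : ℂ) ε) :=
    isCompact_univ_pi fun _ => isCompact_sphere 0 ε
  have hsub : (Set.pi univ fun _ : Fin (r + 1) => Metric.sphere (0 : ℂ) ε) ⊆ torus r := by
    intro y hy
    rw [mem_torus]
    intro i
    have := hy i (mem_univ i)
    rw [mem_sphere_zero_iff_norm] at this
    rw [← norm_pos_iff, this]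
    exact hε
  obtain ⟨C, hC⟩ := hK.exists_bound_of_continuousOn (f.2.1.continuousOn.mono hsub)
  exact ⟨C, fun y _ hyc => hC y fun i _ => mem_sphere_zero_iff_norm.2 (hyc i)⟩

/-- The curve `t ↦ (a with its zero coordinates replaced by t)`, inside the torus for `t ≠ 0` and
tending to `a` as `t → 0`. [cite: SerreGAGA1956, n° 13 Lemme 4] -/
def fill (a : Fin (r + 1) → ℂ) (t : ℂ) : Fin (r + 1) → ℂ := fun i => if a i = 0 then t else a i

/-- `fill a t ∈ T` for `t ≠ 0`. [cite: SerreGAGA1956, n° 13 Lemme 4] -/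
theorem fill_mem_torus (a : Fin (r + 1) → ℂ) {t : ℂ} (ht : t ≠ 0) : fill a t ∈ torus r :=
  mem_torus.2 fun i => by
    unfold fill
    split_ifs with h
    · exact ht
    · exact h

/-- `fill a t → a` as `t → 0`, `t ≠ 0`. [cite: SerreGAGA1956, n° 13 Lemme 4] -/
theorem tendsto_fill (a : Fin (r + 1) → ℂ) : Tendsto (fill a) (𝓝[≠] 0) (𝓝 a) := by
  rw [tendsto_pi_nhds]
  intro i
  by_cases h : a i = 0
  · have : (fun t : ℂ => fill a t i) = id := funext fun t => if_pos h
    rw [this, h]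
    exact tendsto_id.mono_left nhdsWithin_le_nhds
  · have : (fun t : ℂ => fill a t i) = fun _ => a i := funext fun t => if_neg h
    rw [this]
    exact tendsto_const_nhds

/-- **The torus is dense in `ℂ^{r+1}`.** [cite: SerreGAGA1956, n° 13 Lemme 4] -/
theorem dense_torus : Dense (torus r) := fun a =>
  mem_closure_of_tendsto (tendsto_fill a)
    (eventually_mem_nhdsWithin.mono fun _ ht => fill_mem_torus a (mem_compl_singleton_iff.1 ht))

/-- The coordinate cross `ℂ^{r+1} ∖ T = {∏ y_c = 0}` is a thin set in the sense of
`SCV.exists_differentiableOn_eqOn_of_thin`. [cite: SerreGAGA1956, n° 13 Lemme 4] -/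
theorem thin_compl_torus : ∀ a ∈ (torus r)ᶜ ∩ univ, ∃ (φ : (Fin (r + 1) → ℂ) → ℂ)
    (W : Set (Fin (r + 1) → ℂ)), IsOpen W ∧ a ∈ W ∧ W ⊆ univ ∧ DifferentiableOn ℂ φ W ∧
      (∀ x ∈ (torus r)ᶜ ∩ W, φ x = 0) ∧ ¬ φ =ᶠ[𝓝 a] 0 := by
  intro a _
  refine ⟨monoEval 1, univ, isOpen_univ, mem_univ a, Subset.rfl,
    (differentiableOn_monoEval (s := ∅) fun i _ => by simp).mono (by rw [coordCone_empty]),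
    fun x hx => ?_, fun h => ?_⟩
  · obtain ⟨i, hi⟩ : ∃ i, x i = 0 := by
      have := hx.1
      rw [mem_compl_iff, mem_torus] at this
      push Not at this
      exact this
    exact Finset.prod_eq_zero (Finset.mem_univ i) (by rw [hi, Pi.one_apply, zpow_one])
  · obtain ⟨t, ht, ht0⟩ := (((tendsto_fill a).eventually h).and
      (eventually_mem_nhdsWithin (s := ({0}ᶜ : Set ℂ)) (a := 0))).exists
    rw [mem_compl_singleton_iff] at ht0
    refine (Finset.prod_ne_zero_iff.2 fun i _ => ?_) ht
    rw [Pi.one_apply, zpow_one]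
    exact mem_torus.1 (fill_mem_torus a ht0) i

/-- Negating exponents: `x^m ↦ x^{-m}` (the inversion `y = x⁻¹` on Laurent polynomials).
[cite: SerreGAGA1956, n° 13 Lemme 4] -/
def negExp (v : L ℂ r) : L ℂ r := AddMonoidAlgebra.mapDomain (fun m : Expt r => -m) v

/-- `negExp v` evaluates to `v(x⁻¹)`. [cite: SerreGAGA1956, n° 13 Lemme 4] -/
theorem lauEval_negExp (v : L ℂ r) (x : Fin (r + 1) → ℂ) :
    lauEval (negExp v) x = lauEval v x⁻¹ := by
  rw [lauEval_apply, lauEval_apply, negExp, AddMonoidAlgebra.mapDomain,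
    AddMonoidAlgebra.coeff_ofCoeff,
    Finsupp.sum_mapDomain_index (fun _ => zero_mul _) (fun _ _ _ => add_mul _ _ _)]
  refine Finset.sum_congr rfl fun m _ => ?_
  simp only [monoEval, Pi.neg_apply, Pi.inv_apply, zpow_neg, inv_zpow]

/-- `negExp` maps `L_K` to `L_{-K}`. [cite: SerreGAGA1956, n° 13 Lemme 4] -/
theorem negExp_mem_Ldeg {K : ℤ} {v : L ℂ r} (hv : v ∈ Ldeg ℂ r K) : negExp v ∈ Ldeg ℂ r (-K) := by
  rw [mem_Ldeg] at hv ⊢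
  intro m hm
  rw [negExp, AddMonoidAlgebra.mapDomain, AddMonoidAlgebra.coeff_ofCoeff, ← neg_neg m,
    Finsupp.mapDomain_apply neg_injective] at hm
  rw [← neg_neg m, map_neg, hv (-m) hm]

/-- The coordinatewise inverse of a point of the torus lies in the torus.
[cite: SerreGAGA1956, n° 13 Lemme 4] -/
theorem inv_mem_torus {x : Fin (r + 1) → ℂ} (hx : x ∈ torus r) : x⁻¹ ∈ torus r :=
  mem_torus.2 fun i => by rw [Pi.inv_apply]; exact inv_ne_zero (mem_torus.1 hx i)

/-- **Serre's Lemme 4 / the top piece of Frenkel's argument: `π (F_n({0…r})) ⊆ G_n({0…r})`.**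
For `f` holomorphic and homogeneous of degree `n` on the torus, `π f = S_0 ⋯ S_r f` is a Laurent
polynomial of degree `n`: after the inversion `y = x⁻¹`, `π f` is bounded near the coordinate cross
(the iterated principal-part bound `norm_Qop_le`), hence extends to an entire function (Riemann),
homogeneous of degree `-n` (density of the torus), hence a homogeneous polynomial (Liouville).
[cite: SerreGAGA1956, n° 13 Lemme 4 and footnote (4)] -/
theorem πop_mem_algFamily_univ {n : ℤ} {f : holTorus r} (hf : f ∈ holFamily r n Finset.univ) :
    πop r f ∈ algFamily r n Finset.univ := by
  set g : holTorus r := πop r f with hg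
  have hgF : g ∈ holFamily r n Finset.univ :=
    Pop_mem (fun j _ hh => Rop_mem_holFamily_self j _ hh) _ hf
  have hghom := isHomogeneousOn_of_mem_holFamily hgF
  -- the inverted function
  set k : (Fin (r + 1) → ℂ) → ℂ := fun y => (g : (Fin (r + 1) → ℂ) → ℂ) y⁻¹ with hk
  have hinvd : DifferentiableOn ℂ (fun y : Fin (r + 1) → ℂ => y⁻¹) (torus r) := by
    refine differentiableOn_pi.2 fun i => ?_
    simp only [Pi.inv_apply]
    exact ((differentiable_apply i).differentiableOn).inv fun y hy => mem_torus.1 hy i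
  have hkd : DifferentiableOn ℂ k (torus r) := g.2.1.comp hinvd fun y hy => inv_mem_torus hy
  -- local boundedness of `k` near the coordinate cross
  have hbdd : ∀ a ∈ (torus r)ᶜ ∩ univ, ∃ W ∈ 𝓝 a, ∃ C : ℝ, ∀ y ∈ W \ (torus r)ᶜ, ‖k y‖ ≤ C := by
    intro a _
    set ε : ℝ := (2 * (‖a‖ + 1))⁻¹ with hε
    have hεpos : 0 < ε := by positivity
    obtain ⟨C, hC⟩ := exists_bound_on_torus f hεpos
    refine ⟨Metric.ball a 1, Metric.ball_mem_nhds a one_pos, C, fun y hy => ?_⟩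
    have hyT : y ∈ torus r := not_notMem.1 hy.2
    have hyi : ∀ c, 2 * ε ≤ ‖y⁻¹ c‖ := by
      intro c
      have hyc : ‖y c‖ < ‖a‖ + 1 := by
        calc ‖y c‖ ≤ ‖y‖ := norm_le_pi_norm y c
          _ ≤ ‖a‖ + dist y a := by rw [dist_eq_norm]; exact norm_le_insert' y a
          _ < ‖a‖ + 1 := by linarith [Metric.mem_ball.1 hy.1]
      have hyc0 : 0 < ‖y c‖ := norm_pos_iff.2 (mem_torus.1 hyT c)
      rw [Pi.inv_apply, norm_inv, hε, show 2 * (2 * (‖a‖ + 1))⁻¹ = (‖a‖ + 1)⁻¹ by field_simp]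
      exact (inv_le_inv₀ (by positivity) hyc0).2 hyc.le
    rw [hk]
    simp only
    rw [hg, πop_eq_Qop]
    exact norm_Qop_le f hεpos (r + 1) le_rfl _ (inv_mem_torus hyT) (fun c _ => hyi c)
      fun y' hy' _ h2 => hC y' hy' fun c => h2 c (by omega)
  -- Riemann extension across the cross
  have hTeq : univ \ (torus r)ᶜ = torus r := by ext x; simp
  obtain ⟨G, hGd, hGk⟩ :=
    Literature.Analysis.Complex.SCV.exists_differentiableOn_eqOn_of_thin (F := ℂ) (U := univ)
      (A := (torus r)ᶜ) (by rw [hTeq]; exact isOpen_torus) thin_compl_torus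
      (by rw [hTeq]; exact hkd) hbdd
  rw [hTeq] at hGk
  have hGdiff : Differentiable ℂ G := differentiableOn_univ.1 hGd
  -- homogeneity of degree `-n`, first on the torus, then everywhere by density
  have hGhom : ∀ z : Fin (r + 1) → ℂ, ∀ c : ℂ, c ≠ 0 → G (c • z) = c ^ (-n) * G z := by
    intro z c hc
    have hT : EqOn (fun y => G (c • y)) (fun y => c ^ (-n) * G y) (torus r) := by
      intro y hy
      have hcy : c • y ∈ torus r := smul_mem_torus hy hc
      simp only
      rw [hGk hcy, hGk hy, hk]
      simp only
      have hinv : (c • y)⁻¹ = c⁻¹ • y⁻¹ := by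
        funext i; simp [mul_comm]
      rw [hinv, hghom (inv_mem_torus hy) (inv_ne_zero hc), inv_zpow, zpow_neg]
    have hclos := hT.closure ((hGdiff.comp (differentiable_id.const_smul c)).continuous)
      (continuous_const.mul hGdiff.continuous)
    rw [dense_torus.closure_eq] at hclos
    exact hclos (mem_univ z)
  obtain ⟨q, hq, hqdeg⟩ := exists_mvPolynomial_of_homogeneous hGdiff hGhom
  -- the Laurent polynomial `w = q(x⁻¹)`
  have hwdeg : negExp (toL ℂ r q) ∈ Ldeg ℂ r n := by simpa using negExp_mem_Ldeg hqdeg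
  obtain ⟨N, p, hp⟩ := exists_xs_univ_mul_eq_toL (negExp (toL ℂ r q))
  have hgeq : g = holEval r (negExp (toL ℂ r q)) := holTorus_ext fun x hx => by
    rw [coe_holEval_apply hx, lauEval_negExp, lauEval_toL (inv_mem_torus hx), hq,
      hGk (inv_mem_torus hx), hk]
    simp only [inv_inv]
  rw [hgeq]
  exact holEval_mem_algFamily hp hwdeg

/-- **`π (F_n(s)) ⊆ G_n(s)` for every nonempty `s`.** [cite: SerreGAGA1956, n° 13 Lemmes 4–5] -/
theorem πop_mem_algFamily (n : ℤ) :
    ∀ s : Finset (Fin (r + 1)), s.Nonempty → ∀ f ∈ holFamily r n s, πop r f ∈ algFamily r n s := by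
  intro s _ f hf
  by_cases hs : s = Finset.univ
  · subst hs
    exact πop_mem_algFamily_univ hf
  · obtain ⟨j, hj⟩ : ∃ j, j ∉ s := by
      by_contra h
      push Not at h
      exact hs (Finset.eq_univ_iff_forall.2 h)
    rw [πop_eq_zero_of_not_mem hj hf]
    exact Submodule.zero_mem _

/-! ### The comparison theorem -/

variable (r) in
/-- **The holomorphic ordered Čech complex `Č•(𝔘^h; 𝒪(n)^h)` of `ℙ_r(ℂ)`** for the standard cover,
in Serre's cone description (`OrderedCech.complex` of the family `F_n`).
[cite: SerreGAGA1956, n° 13 Lemme 5] -/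
def holCech (n : ℤ) : CochainComplex (ModuleCat.{0} ℂ) ℤ :=
  OrderedCech.complex (holFamily r n) (holFamily_mono n)

/-- `ψ` carries the algebraic members into the holomorphic ones.
[cite: SerreGAGA1956, n° 13 Lemme 5] -/
theorem ψ_mapsTo (n : ℤ) : ∀ s : Finset (Fin (r + 1)),
    ∀ v ∈ locDeg (fun _ : Unit => (0 : ℤ)) (Ktop r) s n, ψ r v ∈ holFamily r n s :=
  fun s _ hv => algFamily_le_holFamily n s (Submodule.mem_map_of_mem hv)

variable (r) in
/-- **The GAGA comparison map for `𝒪(n)` on `ℙ_r(ℂ)`**: evaluation of Serre's algebraic Čech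
cochains
(`LaurentCech.cech (fun _ => 0) ⊤ n`, FAC n° 64) as holomorphic Čech cochains.
[cite: SerreGAGA1956, n° 13 Lemme 5] -/
def cechComparison (n : ℤ) : LaurentCech.cech (fun _ : Unit => (0 : ℤ)) (Ktop r) n ⟶ holCech r n :=
  OrderedCech.complexMap (ψ r) (ψ_mapsTo n) (locDeg_mono (fun _ : Unit => (0 : ℤ)) (Ktop r) n)
    (holFamily_mono n)

/-- `ψ` is injective. [cite: SerreGAGA1956, n° 13 Lemme 5] -/
theorem ψ_eq_zero {v : Unit → L ℂ r} (hv : ψ r v = 0) : v = 0 := by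
  funext u
  rw [ψ_apply, ← (holEval r).map_zero] at hv
  have := holEval_injective hv
  cases u
  exact this

/-- **Serre's GAGA Théorème 1 for the twisting sheaves `𝒪(n)` on `ℙ_r(ℂ)` (n° 13 Lemme 5, with
Lemme 4), by Frenkel's Laurent method (footnote (4)).** The comparison map from the algebraic Čech
complex of `𝒪(n)` to the holomorphic ordered Čech complex of `𝒪(n)^h` on the standard cover of
`ℙ_r(ℂ)` is a quasi-isomorphism, for every `r ≥ 0` and `n ∈ ℤ`.
[cite: SerreGAGA1956, n° 13 Lemmes 4–5 and footnote (4)] -/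
theorem quasiIso_cechComparison (n : ℤ) : QuasiIso (cechComparison r n) := by
  have hGF := algFamily_le_holFamily (r := r) n
  haveI hq : QuasiIso (complexMap LinearMap.id (id_mapsTo_of_le hGF) (algFamily_mono n)
      (holFamily_mono n)) :=
    quasiIso_complexMap_of_coneRetraction (holFamily_mono n) (algFamily_mono n) hGF (Top r) id
      (πop r) (fun k s => Top_mem_holFamily n k s) (fun k s => Top_mem_algFamily n k s)
      (πop_mem_algFamily n) (fun s _ f _ => sum_Top_add_πop_apply f) (holFamily_empty_le n)
  set φ : LaurentCech.cech (fun _ : Unit => (0 : ℤ)) (Ktop r) n ⟶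
      complex (algFamily r n) (algFamily_mono n) :=
    complexMap (ψ r) (fun s v hv => Submodule.mem_map_of_mem hv)
      (locDeg_mono (fun _ : Unit => (0 : ℤ)) (Ktop r) n) (algFamily_mono n) with hφ
  haveI : ∀ k, IsIso (φ.f k) := fun k => by
    rw [hφ, complexMap_f, ConcreteCategory.isIso_iff_bijective]
    refine ⟨Cochain.map_injective _ _ (fun s _ _ hv => ψ_eq_zero hv), Cochain.map_surjective _ _ ?_⟩
    rintro s y ⟨v, hv, rfl⟩
    exact ⟨v, hv, rfl⟩
  haveI : IsIso φ := HomologicalComplex.Hom.isIso_of_components φ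
  haveI hφq : QuasiIso φ := inferInstance
  have hcomp : cechComparison r n =
      φ ≫ complexMap LinearMap.id (id_mapsTo_of_le hGF) (algFamily_mono n) (holFamily_mono n) := by
    refine HomologicalComplex.hom_ext _ _ fun k => ?_
    rw [HomologicalComplex.comp_f, hφ, cechComparison, complexMap_f, complexMap_f, complexMap_f]
    rfl
  rw [hcomp]
  exact quasiIso_comp (hφ := hφq) (hφ' := hq)

end GAGATwist

end Literature.AlgebraicGeometry.HodgeTheory
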